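import Summits.CriticalPhenomena.PercolationContinuityZ3.Theorems.PercNearOneGluingNoHeavyQuantThreePortHairMargin
import Summits.CriticalPhenomena.PercolationContinuityZ3.Theorems.PercNearOneGluingNoHeavyQuantThreePortThreeTenths
import HarnessLib

/-!
# `Z(3,2)` at a three-port observer: the largest hair `≤ 2/5`, and the final map of the unconditional region

builds on p205010 (kernel theorem, internal audit signed; external expert review pending)

Support file (`--supports stmt-CriticalPhenomena-4575`), seat `prim-quant-p1` (gen 5); memo `run/shared/lean/prim/quant/P1-SURPLUS.md` §16.
No definitions, no named facts, no sorries; standard axioms.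

SETTING (`ThreePort`): three-port observer `o` (pairs at `o` other than `o–a, o–b, o–c` have weight `0`), hairs `α, β, γ`, ARBITRARY
finite weighted graph off `o`; `V_v := h_u + h_w − h_u h_w − h_v`.
* `ThreePort.cpair_le_c3` — each pair coefficient of `Σ_v q_v` is below the glued coefficient `c₃`; hence `Σ ≤ s + c₃ = 3·(1 − (1−α)(1−β)(1−γ))`
  pointwise (`sigma_le_glue`): the hypothesis `Σ_v μ(o↔v) > 2` of `Z(3,2)` forces `(1−α)(1−β)(1−γ) < 1/3`.
* `ThreePort.maxTwoFifths_residual_false` — all hairs `≤ 2/5`: either every `V_v ≥ 1/40` (then `hairMargin_residual_false`, p229288) or some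
  `V_v < 1/40`, and then `(1−α)(1−β)(1−γ) > (1 − h_v)(39/40 − h_v) ≥ (3/5)(23/40) > 1/3`, so `Σ < 2`: the dominance collar does not meet the cube
  `[0, 2/5]³` inside the `Z`-hypothesis.
* `ThreePort.le_one_reached_le_of_hairs_le_twoFifths` — **`Z(3,2)` at EVERY three-port observer whose three hairs are `≤ 2/5`.**
* **`ThreePort.le_one_reached_le_threePort`** — the FINAL MAP of the cell-solver method, one citation point: `Z(3,2)` at a three-port observer
  holds as soon as ONE of: (i) some hair `≥ ½` (heavy hair, p214706); (ii) all hairs `≥ 3/10` (p226512); (iii) all hairs `≤ 2/5` (this file);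
  (iv) `h_v + 1/40 ≤ h_u + h_w − h_u h_w` for every `v` (p229288).  The complement — largest hair in `(2/5, ½)`, smallest `< 3/10`, `V < 1/40` at
  the largest hair — contains the lens on which the abstract residual system is satisfiable (`lens_witness`, p227599; kit j101613), so it is
  exactly where a new three-point input (a linear apex-pair row, ineq-gen-8 p220977) is required.
[cite: GladkovZimin2024, Thm. 4.6]; [cite: Gladkov2024, Lemma 1.2 (2)]; [cite: KozmaNitzan2024, Lemma 2 (p. 6)] (context).
-/

noncomputable section

namespace Summit.CriticalPhenomena.PercolationContinuityZ3.Theorems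

open MeasureTheory Set Literature.Probability.LatticeModels Literature.Probability.Percolation
open scoped Classical BigOperators

variable {n : ℕ}

namespace ThreePort

/-! ### `Σ ≤ s + c₃` pointwise -/

/-- The pair coefficient `β+γ−2βγ` is at most the glued coefficient `c₃` (hairs in `[0,1]`):
`c₃ − (β+γ−2βγ) = (β+γ−βγ)(1−α) + α·2(1−β)(1−γ)·…` — affine in `α` with both endpoint values `≥ 0`. [this work] -/
theorem cpair_le_c3 (α β γ : ℝ) (hα0 : 0 ≤ α) (hα1 : α ≤ 1) (hβ0 : 0 ≤ β) (hβ1 : β ≤ 1) (hγ0 : 0 ≤ γ) (hγ1 : γ ≤ 1) :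
    β + γ - 2 * β * γ ≤ (1 - α) * (β + γ - β * γ) + (1 - β) * (α + γ - α * γ) + (1 - γ) * (α + β - α * β) := by
  -- difference = (1−α)·(β+γ−βγ) + α·2(1−β)(1−γ)
  have e : (1 - α) * (β + γ - β * γ) + (1 - β) * (α + γ - α * γ) + (1 - γ) * (α + β - α * β) - (β + γ - 2 * β * γ) =
      (1 - α) * (β + γ - β * γ) + α * (2 * (1 - β) * (1 - γ)) := by ring
  have h1 : 0 ≤ β + γ - β * γ := by nlinarith only [hβ0, hγ0, hγ1]
  have h2 : 0 ≤ (1 - α) * (β + γ - β * γ) := mul_nonneg (by linarith only [hα1]) h1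
  have h3 : 0 ≤ α * (2 * (1 - β) * (1 - γ)) :=
    mul_nonneg hα0 (by nlinarith only [hβ1, hγ1])
  linarith only [e, h2, h3]

/-- **`Σ ≤ s + c₃ = 3(1 − (1−α)(1−β)(1−γ))` pointwise** for nonnegative cells summing to `1` and hairs in `[0,1]`. [this work] -/
theorem sigma_le_glue (α β γ U0 Uab Uac Ubc U3 : ℝ) (hα0 : 0 ≤ α) (hα1 : α ≤ 1) (hβ0 : 0 ≤ β) (hβ1 : β ≤ 1)
    (hγ0 : 0 ≤ γ) (hγ1 : γ ≤ 1) (h0 : 0 ≤ U0) (hab : 0 ≤ Uab) (hac : 0 ≤ Uac) (hbc : 0 ≤ Ubc)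
    (hsum : Uab + Uac + Ubc + U3 + U0 = 1) :
    (α + β + γ) + (α + β - 2 * α * β) * Uab + (α + γ - 2 * α * γ) * Uac + (β + γ - 2 * β * γ) * Ubc +
      ((1 - α) * (β + γ - β * γ) + (1 - β) * (α + γ - α * γ) + (1 - γ) * (α + β - α * β)) * U3 ≤
      3 * (1 - (1 - α) * (1 - β) * (1 - γ)) := by
  set c3 : ℝ := (1 - α) * (β + γ - β * γ) + (1 - β) * (α + γ - α * γ) + (1 - γ) * (α + β - α * β) with hc3
  have hbc' : β + γ - 2 * β * γ ≤ c3 := cpair_le_c3 α β γ hα0 hα1 hβ0 hβ1 hγ0 hγ1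
  have hac' : α + γ - 2 * α * γ ≤ c3 := by
    have := cpair_le_c3 β α γ hβ0 hβ1 hα0 hα1 hγ0 hγ1
    rw [hc3]; linarith only [this]
  have hab' : α + β - 2 * α * β ≤ c3 := by
    have := cpair_le_c3 γ α β hγ0 hγ1 hα0 hα1 hβ0 hβ1
    rw [hc3]; linarith only [this]
  have hc30 : 0 ≤ c3 := by
    have : 0 ≤ β + γ - 2 * β * γ := by nlinarith only [hβ0, hβ1, hγ0, hγ1]
    linarith only [this, hbc']
  have t1 : (α + β - 2 * α * β) * Uab ≤ c3 * Uab := mul_le_mul_of_nonneg_right hab' hab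
  have t2 : (α + γ - 2 * α * γ) * Uac ≤ c3 * Uac := mul_le_mul_of_nonneg_right hac' hac
  have t3 : (β + γ - 2 * β * γ) * Ubc ≤ c3 * Ubc := mul_le_mul_of_nonneg_right hbc' hbc
  have t4 : 0 ≤ c3 * U0 := mul_nonneg hc30 h0
  have e1 : (α + β + γ) + c3 = 3 * (1 - (1 - α) * (1 - β) * (1 - γ)) := by rw [hc3]; ring
  have e2 : c3 * Uab + c3 * Uac + c3 * Ubc + c3 * U3 = c3 - c3 * U0 := by
    have : Uab + Uac + Ubc + U3 = 1 - U0 := by linarith only [hsum]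
    calc c3 * Uab + c3 * Uac + c3 * Ubc + c3 * U3 = c3 * (Uab + Uac + Ubc + U3) := by ring
      _ = c3 - c3 * U0 := by rw [this]; ring
  linarith only [t1, t2, t3, t4, e1, e2]

/-! ### All hairs `≤ 2/5` -/

/-- **Pure real algebra, hairs in `[0, 2/5]³`.**  The residual system of `le_one_reached_le_of_cellSolver₂` is contradictory: if every
`V_v ≥ 1/40` this is `hairMargin_residual_false`; if some `V_v < 1/40` then `(1−h_u)(1−h_w) > 39/40 − h_v`, so
`(1−α)(1−β)(1−γ) > (1−h_v)(39/40−h_v) ≥ (3/5)(23/40) > 1/3` and `Σ ≤ 3(1 − (1−α)(1−β)(1−γ)) < 2`. [this work] -/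
theorem maxTwoFifths_residual_false (α β γ U0 Uab Uac Ubc U3 : ℝ)
    (hα0 : 0 ≤ α) (hα1 : α ≤ 2 / 5) (hβ0 : 0 ≤ β) (hβ1 : β ≤ 2 / 5) (hγ0 : 0 ≤ γ) (hγ1 : γ ≤ 2 / 5)
    (h0 : 0 ≤ U0) (hab : 0 ≤ Uab) (hac : 0 ≤ Uac) (hbc : 0 ≤ Ubc) (h3 : 0 ≤ U3)
    (hsum : Uab + Uac + Ubc + U3 + U0 = 1)
    (ga : U0 * ((1 - α) * β * γ - α * (1 - β) * (1 - γ)) + Ubc * (β + γ - β * γ - α) < 0)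
    (gb : U0 * ((1 - β) * α * γ - β * (1 - α) * (1 - γ)) + Uac * (α + γ - α * γ - β) < 0)
    (gc : U0 * ((1 - γ) * α * β - γ * (1 - α) * (1 - β)) + Uab * (α + β - α * β - γ) < 0)
    (hGZa : (U0 + Ubc) * (Uab + Uac + U3) ≤ Uab + Uac + Ubc)
    (hGZb : (U0 + Uac) * (Uab + Ubc + U3) ≤ Uab + Uac + Ubc)
    (hGZc : (U0 + Uab) * (Uac + Ubc + U3) ≤ Uab + Uac + Ubc)
    (rA1 : U0 ^ 2 ≤ (Uac + U0) * (Uab + (Ubc + U0) ^ 2)) (rA2 : U0 ^ 2 ≤ (Uab + U0) * (Uac + (Ubc + U0) ^ 2))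
    (rB1 : U0 ^ 2 ≤ (Ubc + U0) * (Uab + (Uac + U0) ^ 2)) (rB2 : U0 ^ 2 ≤ (Uab + U0) * (Ubc + (Uac + U0) ^ 2))
    (rC1 : U0 ^ 2 ≤ (Ubc + U0) * (Uac + (Uab + U0) ^ 2)) (rC2 : U0 ^ 2 ≤ (Uac + U0) * (Ubc + (Uab + U0) ^ 2))
    (hSig : 2 < (α + β + γ) + (α + β - 2 * α * β) * Uab + (α + γ - 2 * α * γ) * Uac + (β + γ - 2 * β * γ) * Ubc +
      ((1 - α) * (β + γ - β * γ) + (1 - β) * (α + γ - α * γ) + (1 - γ) * (α + β - α * β)) * U3) : False := by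
  have hSle := sigma_le_glue α β γ U0 Uab Uac Ubc U3 hα0 (by linarith only [hα1]) hβ0 (by linarith only [hβ1]) hγ0
    (by linarith only [hγ1]) h0 hab hac hbc hsum
  -- so `(1−α)(1−β)(1−γ) < 1/3`
  have hprod : (1 - α) * (1 - β) * (1 - γ) < 1 / 3 := by linarith only [hSle, hSig]
  by_cases hVa : 1 / 40 ≤ β + γ - β * γ - α
  · by_cases hVb : 1 / 40 ≤ α + γ - α * γ - β
    · by_cases hVc : 1 / 40 ≤ α + β - α * β - γ
      · exact hairMargin_residual_false α β γ U0 Uab Uac Ubc U3 hα0 (by linarith only [hα1]) hβ0 (by linarith only [hβ1]) hγ0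
          (by linarith only [hγ1]) hVa hVb hVc h0 hab hac hbc h3 hsum ga gb gc hGZa hGZb hGZc rA1 rA2 rB1 rB2 rC1 rC2 hSig
      · -- `V_c < 1/40`: `(1−α)(1−β) > 39/40 − γ`, times `(1−γ) ≥ 3/5`
        push Not at hVc
        have h1 : 39 / 40 - γ < (1 - α) * (1 - β) := by
          have e1 : (1 - α) * (1 - β) = 1 - (α + β - α * β) := by ring
          rw [e1]; linarith only [hVc]
        have h2 : (39 / 40 - γ) * (1 - γ) ≤ (1 - α) * (1 - β) * (1 - γ) :=
          mul_le_mul_of_nonneg_right h1.le (by linarith only [hγ1])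
        nlinarith only [h2, hprod, hγ1, hγ0]
    · push Not at hVb
      have h1 : 39 / 40 - β < (1 - α) * (1 - γ) := by
        have e1 : (1 - α) * (1 - γ) = 1 - (α + γ - α * γ) := by ring
        rw [e1]; linarith only [hVb]
      have h2 : (39 / 40 - β) * (1 - β) ≤ (1 - α) * (1 - γ) * (1 - β) :=
        mul_le_mul_of_nonneg_right h1.le (by linarith only [hβ1])
      have e : (1 - α) * (1 - γ) * (1 - β) = (1 - α) * (1 - β) * (1 - γ) := by ring
      nlinarith only [h2, hprod, hβ1, hβ0, e]
  · push Not at hVa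
    have h1 : 39 / 40 - α < (1 - β) * (1 - γ) := by
      have e1 : (1 - β) * (1 - γ) = 1 - (β + γ - β * γ) := by ring
      rw [e1]; linarith only [hVa]
    have h2 : (39 / 40 - α) * (1 - α) ≤ (1 - β) * (1 - γ) * (1 - α) :=
      mul_le_mul_of_nonneg_right h1.le (by linarith only [hα1])
    have e : (1 - β) * (1 - γ) * (1 - α) = (1 - α) * (1 - β) * (1 - γ) := by ring
    nlinarith only [h2, hprod, hα1, hα0, e]

/-- **`Z(3,2)` at every three-port observer whose three hairs are `≤ 2/5`** (for every finite weighted graph off `o`): if `o` is adjacent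
(with positive weight) only to `a, b, c`, all hairs are `≤ 2/5`, `Σ_v μ(o↔v) > 2` and `t ≥ μ(o↮v)` for `v = a, b, c`, then
`μ{o reaches at most one of a, b, c} ≤ t`. [this work] -/
theorem le_one_reached_le_of_hairs_le_twoFifths (w : Sym2 (Fin n) → unitInterval) (R : Finset (Fin n)) (o a b c : Fin n)
    (t : ℝ) (hR : R = {a, b, c}) (hao : a ≠ o) (hbo : b ≠ o) (hco : c ≠ o) (hab : a ≠ b) (hac : a ≠ c) (hbc : b ≠ c)
    (hobs : ∀ u, u ≠ o → u ≠ a → u ≠ b → u ≠ c → w s(o, u) = 0)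
    (hαhi : (w s(o, a) : ℝ) ≤ 2 / 5) (hβhi : (w s(o, b) : ℝ) ≤ 2 / 5) (hγhi : (w s(o, c) : ℝ) ≤ 2 / 5)
    (hsum : 2 < (prodBernoulli w).real (openConn o a) + (prodBernoulli w).real (openConn o b) +
      (prodBernoulli w).real (openConn o c))
    (hta : (prodBernoulli w).real (openConn o a)ᶜ ≤ t) (htb : (prodBernoulli w).real (openConn o b)ᶜ ≤ t)
    (htc : (prodBernoulli w).real (openConn o c)ᶜ ≤ t) :
    (prodBernoulli w).real {ω : BondConfig (Fin n) | (R.filter fun v => ω ∈ openConn o v).card ≤ 1} ≤ t :=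
  le_one_reached_le_of_cellSolver₂ w R o a b c t hR hao hbo hco hab hac hbc hobs
    (fun U0 Uab Uac Ubc U3 h0 hab' hac' hbc' h3 hs ga gb gc hGZa hGZb hGZc rA1 rA2 rB1 rB2 rC1 rC2 hSig =>
      maxTwoFifths_residual_false _ _ _ U0 Uab Uac Ubc U3 (w s(o, a)).2.1 hαhi (w s(o, b)).2.1 hβhi (w s(o, c)).2.1 hγhi
        h0 hab' hac' hbc' h3 hs ga gb gc hGZa hGZb hGZc rA1 rA2 rB1 rB2 rC1 rC2 hSig)
    hsum hta htb htc

/-! ### The final map -/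

/-- **`Z(3,2)` at a three-port observer — final map of the unconditional region.**  For a three-port observer `o` onto `a, b, c`
(arbitrary finite weighted graph off `o`) with `Σ_v μ(o↔v) > 2` and `t ≥ μ(o↮v)` (`v = a,b,c`): `μ{o reaches at most one of a,b,c} ≤ t`
provided ONE of (i) some hair `≥ ½`; (ii) all hairs `≥ 3/10`; (iii) all hairs `≤ 2/5`; (iv) `h_v + 1/40 ≤ h_u + h_w − h_u h_w` for each `v`.
The excluded set (largest hair in `(2/5, ½)`, smallest `< 3/10`, margin `< 1/40` at the largest hair) contains the lens of `lens_witness`,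
where no cell solver from the proved rows exists. [this work] -/
theorem le_one_reached_le_threePort (w : Sym2 (Fin n) → unitInterval) (R : Finset (Fin n)) (o a b c : Fin n)
    (t : ℝ) (hR : R = {a, b, c}) (hao : a ≠ o) (hbo : b ≠ o) (hco : c ≠ o) (hab : a ≠ b) (hac : a ≠ c) (hbc : b ≠ c)
    (hobs : ∀ u, u ≠ o → u ≠ a → u ≠ b → u ≠ c → w s(o, u) = 0)
    (hregion : ((1 / 2 : ℝ) ≤ w s(o, a) ∨ (1 / 2 : ℝ) ≤ w s(o, b) ∨ (1 / 2 : ℝ) ≤ w s(o, c)) ∨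
      ((3 / 10 : ℝ) ≤ w s(o, a) ∧ (3 / 10 : ℝ) ≤ w s(o, b) ∧ (3 / 10 : ℝ) ≤ w s(o, c)) ∨
      ((w s(o, a) : ℝ) ≤ 2 / 5 ∧ (w s(o, b) : ℝ) ≤ 2 / 5 ∧ (w s(o, c) : ℝ) ≤ 2 / 5) ∨
      ((w s(o, a) : ℝ) + 1 / 40 ≤ w s(o, b) + w s(o, c) - w s(o, b) * w s(o, c) ∧
        (w s(o, b) : ℝ) + 1 / 40 ≤ w s(o, a) + w s(o, c) - w s(o, a) * w s(o, c) ∧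
        (w s(o, c) : ℝ) + 1 / 40 ≤ w s(o, a) + w s(o, b) - w s(o, a) * w s(o, b)))
    (hsum : 2 < (prodBernoulli w).real (openConn o a) + (prodBernoulli w).real (openConn o b) +
      (prodBernoulli w).real (openConn o c))
    (hta : (prodBernoulli w).real (openConn o a)ᶜ ≤ t) (htb : (prodBernoulli w).real (openConn o b)ᶜ ≤ t)
    (htc : (prodBernoulli w).real (openConn o c)ᶜ ≤ t) :
    (prodBernoulli w).real {ω : BondConfig (Fin n) | (R.filter fun v => ω ∈ openConn o v).card ≤ 1} ≤ t := by
  rcases hregion with hhalf | hlo | hhi | hV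
  · -- (i) a heavy hair: exchange at the weakest target
    have ha : a ∈ R := (by simp [hR]); have hb : b ∈ R := (by simp [hR]); have hc : c ∈ R := by simp [hR]
    have hobs' : ∀ u, u ≠ o → u ≠ b → u ≠ a → u ≠ c → w s(o, u) = 0 := fun u h1 h2 h3 h4 => hobs u h1 h3 h2 h4
    have hobs'' : ∀ u, u ≠ o → u ≠ c → u ≠ a → u ≠ b → w s(o, u) = 0 := fun u h1 h2 h3 h4 => hobs u h1 h3 h4 h2
    set μ := prodBernoulli w with hμ
    rcases le_total (μ.real (openConn o a)) (μ.real (openConn o b)) with hqab | hqba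
    · rcases le_total (μ.real (openConn o a)) (μ.real (openConn o c)) with hqac | hqca
      · exact (OneCutFive.measureReal_le_one_le_compl_of_exchange w R o a b c ha hb hc hab hac hbc
          (pocketExchange_of_half_le_hair w o a b c hao hbo hco hab hac hbc hobs hhalf hqab hqac)).trans hta
      · have hhalf' : (1 / 2 : ℝ) ≤ w s(o, c) ∨ (1 / 2 : ℝ) ≤ w s(o, a) ∨ (1 / 2 : ℝ) ≤ w s(o, b) := by tauto
        exact (OneCutFive.measureReal_le_one_le_compl_of_exchange w R o c a b hc ha hb hac.symm hbc.symm hab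
          (pocketExchange_of_half_le_hair w o c a b hco hao hbo hac.symm hbc.symm hab hobs'' hhalf' hqca
            (hqca.trans hqab))).trans htc
    · rcases le_total (μ.real (openConn o b)) (μ.real (openConn o c)) with hqbc | hqcb
      · have hhalf' : (1 / 2 : ℝ) ≤ w s(o, b) ∨ (1 / 2 : ℝ) ≤ w s(o, a) ∨ (1 / 2 : ℝ) ≤ w s(o, c) := by tauto
        exact (OneCutFive.measureReal_le_one_le_compl_of_exchange w R o b a c hb ha hc hab.symm hbc hac
          (pocketExchange_of_half_le_hair w o b a c hbo hao hco hab.symm hbc hac hobs' hhalf' hqba hqbc)).trans htb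
      · have hhalf' : (1 / 2 : ℝ) ≤ w s(o, c) ∨ (1 / 2 : ℝ) ≤ w s(o, a) ∨ (1 / 2 : ℝ) ≤ w s(o, b) := by tauto
        exact (OneCutFive.measureReal_le_one_le_compl_of_exchange w R o c a b hc ha hb hac.symm hbc.symm hab
          (pocketExchange_of_half_le_hair w o c a b hco hao hbo hac.symm hbc.symm hab hobs'' hhalf' (hqcb.trans hqba)
            hqcb)).trans htc
  · exact le_one_reached_le_of_hairs_ge_threeTenths w R o a b c t hR hao hbo hco hab hac hbc hobs hlo.1 hlo.2.1 hlo.2.2 hsum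
      hta htb htc
  · exact le_one_reached_le_of_hairs_le_twoFifths w R o a b c t hR hao hbo hco hab hac hbc hobs hhi.1 hhi.2.1 hhi.2.2 hsum
      hta htb htc
  · exact le_one_reached_le_of_hairMargin w R o a b c t hR hao hbo hco hab hac hbc hobs hV.1 hV.2.1 hV.2.2 hsum hta htb htc

end ThreePort

end Summit.CriticalPhenomena.PercolationContinuityZ3.Theorems

end
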